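import Mathlib
import HarnessLib
import Literature.Analysis.FluidPDE.Tao2016AveragedNS.LocalCascadeSolutions
import Literature.Analysis.FluidPDE.Tao2016AveragedNS.RenormalisedCascadeWaves
import Literature.Analysis.FluidPDE.Tao2016AveragedNS.ViscousEternalSolutions
import Literature.Analysis.FluidPDE.Tao2016AveragedNS.SelfSimilarCascadeBlowup
import Literature.Analysis.FluidPDE.Tao2016AveragedNS.BoundedEternalSolutions
import Summits.NavierStokesRegularity.NavierStokesRegularity.Theorems.TaoLadderRungTwoBreakNoSurvivingEternalViscBddOneTailBarrier
import Summits.NavierStokesRegularity.NavierStokesRegularity.Theorems.TaoLadderRungTwoBreakNoSurvivingDSSOneLeadingEdge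

/-!
# Crux K1ᵛ(1) `TaoLadderRungTwoBreak.NoSurvivingEternalViscBddOne` (stmt-NavierStokesRegularity-20419):
# the FRONT SPEED LIMIT — a hop of the front costs log-time `≥ Δ(B)`, for every bounded admissible
# eternal solution with covariant viscosity `ν̂ ≥ 0`; hence a DELAY FLOOR for admissible DSS waves

MODEL lattice ODEs only (Tao 2016 §4 in the self-similar log-time variables of §6.4); nothing in this file
is a statement about the Navier–Stokes equations, and no summit or rung LEAF is proved by it
(`--supports stmt-NavierStokesRegularity-20419 --as helper`).  General `m`, any cancelling table, every
`ε₀ > 0`, every `ν̂ ≥ 0`; `C_A = fluxConst α`, `Λ = bigLam ε₀`.  Quantitative companion of the tail barrier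
(`…TailBarrier`: ordered ignition is qualitative — WHO ignites first; here: HOW FAST).

* `normSq_le_rise` — the fence started at a finite time: a bracket bound `≤ b²` on `[σ₁, σ₂]` gives
  `‖W_k(σ)‖² ≤ ‖W_k(σ₁)‖² e^{σ₁-σ} + b² (1 - e^{σ₁-σ})` — a shell rises towards the ceiling `b` at unit
  exponential rate at most, whatever feeds it.
* `hop_time` — THE HOP-TIME LOWER BOUND: with the uniform bound `B`, `b = 2ΛC_A B²`, a margin level `q`
  (`4 C_A q ≤ Λ`, `2ΛC_A q² < q`, `q < b`) and `a = 2ΛC_A q²`: if the tail `k ≥ n+1` was quiet at level `q` in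
  some past and the shell `n` has not reached `q` by log-time `σ`, then NO shell `k ≥ n+1` reaches `q` before
  `σ + Δ`, `Δ = log((b² - a²)/(b² - q²)) > 0` (barrier ⇒ the tail is slaved at `a` up to `σ`; real induction
  on `[σ, σ+Δ]` with the rise bound and the sign-free growth bound).
* `frontSpeedLimit` — iterating: the shells `k ≥ n + j` stay `≤ q` on `(-∞, σ + jΔ]` for every `j`: the
  front of a bounded admissible eternal solution climbs AT MOST ONE SHELL PER `Δ(B, q)` OF LOG-TIME,
  uniformly in `ν̂ ≥ 0` (for `ν̂ > 0` compare the dissipation line `σ ≥ 2k log(1+ε₀) - O(1)` of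
  `farPastDecay_all`; this bound needs no viscosity).
* `dss_delay_ge` — for an admissible DSS wave of a cancelling table whose profiles reach a margin level
  `q` somewhere: the DELAY obeys `T ≥ Δ(B, q)` with `B = sup‖Φ‖` (shell `p = orderOf π` repeats shell `0`
  after `pT`, and needs `p` hops).  Since `Δ(B,q) ≍ q²/(2ΛC_AB²)²` for large `B`, fast waves (small `T`,
  e.g. the sub-unitary ones, `T < log Λ ≈ 2.5 ε₀`) are TALL: `B⁴ ≳ q²/(Λ²C_A² T)` — an amplitude floor
  for ALL admissible DSS waves, surviving or not (the tree's sharper floor `≈ 1/(5C_Aε₀)`,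
  `…WeightedGrowth`, is for (S₁)-surviving waves).

HONEST LABEL: structure lemmas; `stub_noSurvivingEternalBddOne`, `stub_noLoudLadderOne`, `stub_eternalLiouville`
and the cruxes ⟨20419⟩/⟨20205⟩ stay OPEN; rung 0.
-/

noncomputable section

-- the summit and its single sub-problem share the name (CONVENTIONS §1)
set_option linter.dupNamespace false

namespace Summit.NavierStokesRegularity.NavierStokesRegularity.Theorems.NoSurvivingEternalViscBddOne.TailBarrier

open Set Filter Topology MeasureTheory
open scoped RealInnerProductSpace
open Literature.Analysis.FluidPDE Literature.Analysis.FluidPDE.TaoCascade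
open Summit.NavierStokesRegularity.NavierStokesRegularity.Theorems.NoSurvivingDSSOne.LeadingEdge

variable {m : ℕ} {ε₀ νh : ℝ} {α : Fin m → Fin m → Fin m → ℤ × ℤ × ℤ → ℝ} {W : ℤ → ℝ → Em m}

/-! ## The fence started at a finite time -/

/-- **Rise bound.**  If the half-damped bracket of shell `k` is `≤ b²` on `[σ₁, σ₂]`, then for
`σ ∈ [σ₁, σ₂]`: `‖W_k(σ)‖² ≤ ‖W_k(σ₁)‖² e^{σ₁-σ} + b² (1 - e^{σ₁-σ})` (the fence `e^{σ}‖W_k‖² - b²e^{σ}` is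
antitone on `[σ₁, σ₂]`).
[cite: Tao2016AveragedNS, §4 (4.1), (4.3), Lemma 4.1 (4.8); §6.4] -/
theorem normSq_le_rise (hW : IsEternalVisc ε₀ νh α W) (hc : IsCancellingCoeff α)
    {k : ℤ} {σ₁ σ₂ b : ℝ}
    (hbr : ∀ x, σ₁ ≤ x → x ≤ σ₂ → -‖W k x‖ ^ 2 + 2 * bigLam ε₀ * ⟪W k x, tableA α (W (k - 1) x)⟫
        - 2 * (bigLam ε₀)⁻¹ * ⟪W (k + 1) x, tableA α (W k x)⟫
        - 2 * viscCoef ε₀ νh k x * ‖W k x‖ ^ 2 ≤ b ^ 2) :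
    ∀ σ, σ₁ ≤ σ → σ ≤ σ₂ →
      ‖W k σ‖ ^ 2 ≤ ‖W k σ₁‖ ^ 2 * Real.exp (σ₁ - σ) + b ^ 2 * (1 - Real.exp (σ₁ - σ)) := by
  set g : ℝ → ℝ := fun x => Real.exp (1 * x) * ‖W k x‖ ^ 2 - b ^ 2 * Real.exp x with hg
  have hderiv : ∀ x, HasDerivAt g
      (Real.exp (1 * x) * ((1 - 2) * ‖W k x‖ ^ 2 + 2 * bigLam ε₀ * ⟪W k x, tableA α (W (k - 1) x)⟫
        - 2 * (bigLam ε₀)⁻¹ * ⟪W (k + 1) x, tableA α (W k x)⟫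
        - 2 * viscCoef ε₀ νh k x * ‖W k x‖ ^ 2) - b ^ 2 * Real.exp x) x := by
    intro x
    exact (hasDerivAt_expWeight hW hc 1 k x).sub ((Real.hasDerivAt_exp x).const_mul (b ^ 2))
  have hdiff : Differentiable ℝ g := fun x => (hderiv x).differentiableAt
  have hanti : AntitoneOn g (Icc σ₁ σ₂) := by
    apply antitoneOn_of_deriv_nonpos (convex_Icc σ₁ σ₂) hdiff.continuous.continuousOn
      (hdiff.differentiableOn.mono interior_subset)
    intro x hx
    rw [interior_Icc] at hx
    rw [(hderiv x).deriv]
    have h1 : (1 - 2 : ℝ) * ‖W k x‖ ^ 2 = -‖W k x‖ ^ 2 := by ring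
    rw [h1, one_mul]
    have hex : 0 ≤ Real.exp x := (Real.exp_pos x).le
    nlinarith [mul_le_mul_of_nonneg_left (hbr x hx.1.le hx.2.le) hex]
  intro σ h1 h2
  have hmono : g σ ≤ g σ₁ := hanti ⟨le_rfl, h1.trans h2⟩ ⟨h1, h2⟩ h1
  simp only [hg, one_mul] at hmono
  have hexp : Real.exp σ₁ = Real.exp (σ₁ - σ) * Real.exp σ := by
    rw [← Real.exp_add]; congr 1; ring
  rw [hexp] at hmono
  have hσ : 0 < Real.exp σ := Real.exp_pos σ
  -- divide by e^{σ}
  have h3 : Real.exp σ * ‖W k σ‖ ^ 2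
      ≤ Real.exp σ * (‖W k σ₁‖ ^ 2 * Real.exp (σ₁ - σ) + b ^ 2 * (1 - Real.exp (σ₁ - σ))) := by
    nlinarith
  exact le_of_mul_le_mul_left h3 hσ

/-! ## The hop-time lower bound -/

/-- **THE HOP-TIME LOWER BOUND (any `ν̂ ≥ 0`).**  Let `W` be an admissible eternal solution with covariant
viscosity of a cancelling table with `‖W‖ ≤ B`, `b = 2ΛC_A B²`, and `q` a margin level (`4 C_A q ≤ Λ`,
`2ΛC_A q² < q`, `q < b`); put `a = 2ΛC_A q²` and `Δ = log((b² - a²)/(b² - q²))`.  If the tail `k ≥ n + 1` was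
quiet at level `q` on some `(-∞, σ₀]`, `σ₀ ≤ σ`, and the shell `n` satisfies `‖W_n‖ ≤ q` on `(-∞, σ]`, then
every shell `k ≥ n + 1` satisfies `‖W_k(t)‖ ≤ q` for all `t ≤ σ + Δ`: the next shell ignites at least `Δ`
after the current one.
[cite: Tao2016AveragedNS, §4 (4.1), (4.3), Lemma 4.1 (4.8); §5 (transit times of the cascade); §6.4] -/
theorem hop_time (hε : 0 < ε₀) (hW : IsEternalVisc ε₀ νh α W) (hc : IsCancellingCoeff α)
    {B : ℝ} (hB : ∀ (k : ℤ) (σ : ℝ), ‖W k σ‖ ≤ B) {n : ℤ} {σ₀ σ q : ℝ} (h0σ : σ₀ ≤ σ)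
    (hq4 : 4 * fluxConst α * q ≤ bigLam ε₀) (hq2 : 2 * bigLam ε₀ * fluxConst α * q ^ 2 < q)
    (hqb : q < 2 * bigLam ε₀ * fluxConst α * B ^ 2)
    (h0 : ∀ k : ℤ, n + 1 ≤ k → ∀ s, s ≤ σ₀ → ‖W k s‖ ≤ q)
    (hn : ∀ s, s ≤ σ → ‖W n s‖ ≤ q) :
    ∀ k : ℤ, n + 1 ≤ k → ∀ t,
      t ≤ σ + Real.log (((2 * bigLam ε₀ * fluxConst α * B ^ 2) ^ 2 - (2 * bigLam ε₀ * fluxConst α * q ^ 2) ^ 2)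
            / ((2 * bigLam ε₀ * fluxConst α * B ^ 2) ^ 2 - q ^ 2)) →
      ‖W k t‖ ≤ q := by
  have hΛ : 0 < bigLam ε₀ := bigLam_pos (by linarith)
  have hCA : 0 ≤ fluxConst α := fluxConst_nonneg α
  have hq0 : 0 < q := lt_of_le_of_lt (by positivity) hq2
  have hB0 : 0 ≤ B := (norm_nonneg _).trans (hB n σ)
  set b : ℝ := 2 * bigLam ε₀ * fluxConst α * B ^ 2 with hb
  set a : ℝ := 2 * bigLam ε₀ * fluxConst α * q ^ 2 with ha
  have ha0 : 0 ≤ a := by positivity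
  have haq : a < q := hq2
  have hb0 : 0 < b := hq0.trans hqb
  have hden : 0 < b ^ 2 - q ^ 2 := by nlinarith
  have hnum : b ^ 2 - q ^ 2 < b ^ 2 - a ^ 2 := by nlinarith
  have hnum0 : 0 < b ^ 2 - a ^ 2 := hden.trans hnum
  set Δ : ℝ := Real.log ((b ^ 2 - a ^ 2) / (b ^ 2 - q ^ 2)) with hΔ
  have hratio : 1 < (b ^ 2 - a ^ 2) / (b ^ 2 - q ^ 2) := (one_lt_div hden).2 hnum
  have hΔ0 : 0 < Δ := Real.log_pos hratio
  have hU : UniformBound W := ⟨B, hB⟩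
  -- Step A: the barrier keeps the tail ≤ q up to σ
  have hA : ∀ k : ℤ, n + 1 ≤ k → ∀ s, s ≤ σ → ‖W k s‖ ≤ q := by
    have hn' : ∀ s, s ≤ σ → ‖W (n + 1 - 1) s‖ ≤ q := by
      intro s hs; rw [add_sub_cancel_right]; exact hn s hs
    exact tail_barrier hε hW hc hU h0σ hq4 hq2 hq2 hn' h0
  -- Step B: at time σ the tail is slaved at level a
  have hBslave : ∀ k : ℤ, n + 1 ≤ k → ∀ s, s ≤ σ → ‖W k s‖ ≤ a := by
    intro k hk s hs
    have hmar : ∀ s', s' ≤ σ → 4 * fluxConst α * ‖W (k + 1) s'‖ ≤ bigLam ε₀ := by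
      intro s' hs'
      calc 4 * fluxConst α * ‖W (k + 1) s'‖ ≤ 4 * fluxConst α * q :=
            mul_le_mul_of_nonneg_left (hA (k + 1) (by omega) s' hs') (by positivity)
        _ ≤ bigLam ε₀ := hq4
    have hdrv : ∀ s', s' ≤ σ → ‖W (k - 1) s'‖ ≤ q := by
      intro s' hs'
      rcases eq_or_lt_of_le hk with hkn | hkn
      · rw [← hkn, add_sub_cancel_right]; exact hn s' hs'
      · exact hA (k - 1) (by omega) s' hs'
    exact norm_le_slaved hε hW hc hdrv hmar (fun s' _ => hB k s') s hs
  -- Step C: real induction on [σ, σ + Δ]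
  have hcont : ∀ k : ℤ, Continuous (W k) := fun k =>
    continuous_iff_continuousAt.2 fun x => (hW.law k x).continuousAt
  set S : Set ℝ := {t | ∀ k : ℤ, n + 1 ≤ k → ∀ r : ℝ, ‖W k (min r t)‖ ≤ q} with hS
  have hSiff : ∀ t, t ∈ S ↔ ∀ k : ℤ, n + 1 ≤ k → ∀ s, s ≤ t → ‖W k s‖ ≤ q := by
    intro t
    constructor
    · intro ht k hk s hs
      have := ht k hk s
      rwa [min_eq_left hs] at this
    · intro ht k hk r
      exact ht k hk (min r t) (min_le_right r t)
  have hSclosed : IsClosed S := by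
    have hS' : S = ⋂ k : ℤ, ⋂ (_ : n + 1 ≤ k), ⋂ r : ℝ, {t | ‖W k (min r t)‖ ≤ q} := by
      ext t; simp only [hS, mem_setOf_eq, mem_iInter]
    rw [hS']
    refine isClosed_iInter fun k => isClosed_iInter fun _ => isClosed_iInter fun r => ?_
    exact isClosed_le ((hcont k).comp (continuous_const.min continuous_id)).norm continuous_const
  -- the rise profile ψ(x) = a² e^{σ-x} + b² (1 - e^{σ-x}) is < q² strictly before σ + Δ
  have hψ : ∀ x, σ ≤ x → x < σ + Δ →
      a ^ 2 * Real.exp (σ - x) + b ^ 2 * (1 - Real.exp (σ - x)) < q ^ 2 := by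
    intro x hx1 hx2
    have h1 : Real.exp (-Δ) < Real.exp (σ - x) := Real.exp_lt_exp.2 (by linarith)
    have h2 : Real.exp (-Δ) = (b ^ 2 - q ^ 2) / (b ^ 2 - a ^ 2) := by
      rw [hΔ, Real.exp_neg, Real.exp_log (by positivity), inv_div]
    rw [h2] at h1
    have h3 : b ^ 2 - q ^ 2 < Real.exp (σ - x) * (b ^ 2 - a ^ 2) := by
      have := (div_lt_iff₀ hnum0).1 h1
      linarith
    nlinarith
  set L : ℝ := 2 * fluxConst α * (bigLam ε₀ + (bigLam ε₀)⁻¹) * B ^ 3 with hL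
  have hL0 : 0 ≤ L := by positivity
  have hmem : σ + Δ ∈ S := by
    refine IsClosed.mem_of_ge_of_forall_exists_gt (hSclosed.inter isClosed_Icc)
      ((hSiff σ).2 hA) (by linarith) ?_
    rintro x ⟨hxS, hx0, hx1⟩
    have hPx := (hSiff x).1 hxS
    -- rise bound for every tail shell on [σ, x]
    have hrise : ∀ k : ℤ, n + 1 ≤ k →
        ‖W k x‖ ^ 2 ≤ a ^ 2 * Real.exp (σ - x) + b ^ 2 * (1 - Real.exp (σ - x)) := by
      intro k hk
      have hbr : ∀ y, σ ≤ y → y ≤ x → -‖W k y‖ ^ 2 + 2 * bigLam ε₀ * ⟪W k y, tableA α (W (k - 1) y)⟫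
          - 2 * (bigLam ε₀)⁻¹ * ⟪W (k + 1) y, tableA α (W k y)⟫
          - 2 * viscCoef ε₀ νh k y * ‖W k y‖ ^ 2 ≤ b ^ 2 := by
        intro y _ hy2
        have hmar : 4 * fluxConst α * ‖W (k + 1) y‖ ≤ bigLam ε₀ := by
          calc 4 * fluxConst α * ‖W (k + 1) y‖ ≤ 4 * fluxConst α * q :=
                mul_le_mul_of_nonneg_left (hPx (k + 1) (by omega) y hy2) (by positivity)
            _ ≤ bigLam ε₀ := hq4
        exact bracket_le hε hW.nonneg hc (hB (k - 1) y) hmar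
      have h1 := normSq_le_rise hW hc hbr x hx0 le_rfl
      have h2 : ‖W k σ‖ ^ 2 ≤ a ^ 2 := pow_le_pow_left₀ (norm_nonneg _) (hBslave k hk σ le_rfl) 2
      have h3 : 0 ≤ Real.exp (σ - x) := (Real.exp_pos _).le
      nlinarith [mul_le_mul_of_nonneg_right h2 h3]
    set ψ : ℝ := a ^ 2 * Real.exp (σ - x) + b ^ 2 * (1 - Real.exp (σ - x)) with hψdef
    have hψq : ψ < q ^ 2 := hψ x hx0 hx1
    set δ : ℝ := (q ^ 2 - ψ) / (L + 1) with hδ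
    have hδ0 : 0 < δ := div_pos (by linarith) (by linarith)
    have hLδ : L * δ ≤ q ^ 2 - ψ := by
      rw [hδ, mul_div_assoc']
      rw [div_le_iff₀ (by linarith : (0:ℝ) < L + 1)]
      nlinarith
    set y : ℝ := min (σ + Δ) (x + δ) with hy
    refine ⟨y, (hSiff y).2 ?_, lt_min hx1 (by linarith), min_le_left _ _⟩
    intro k hk s hs
    rcases le_or_gt s x with hsx | hsx
    · exact hPx k hk s hsx
    · have h1 := normSq_le_add_mul hε hW hc hB k hsx.le
      have h2 : s - x ≤ δ := by
        have : s ≤ x + δ := hs.trans (min_le_right _ _)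
        linarith
      have h4 : ‖W k s‖ ^ 2 ≤ q ^ 2 := by
        have : L * (s - x) ≤ L * δ := mul_le_mul_of_nonneg_left h2 hL0
        rw [← hL] at h1
        linarith [hrise k hk]
      exact (pow_le_pow_iff_left₀ (norm_nonneg _) hq0.le two_ne_zero).1 h4
  intro k hk t ht
  exact (hSiff (σ + Δ)).1 hmem k hk t ht

/-- **THE FRONT SPEED LIMIT (any `ν̂ ≥ 0`).**  In the setting of `hop_time`: for every `j : ℕ`, every shell
`k ≥ n + j` satisfies `‖W_k(t)‖ ≤ q` for all `t ≤ σ + j·Δ` — the front of a bounded admissible eternal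
solution climbs at most one shell per `Δ(B, q) = log((b² - a²)/(b² - q²))` of log-time.
[cite: Tao2016AveragedNS, §4 (4.1), (4.3), Lemma 4.1 (4.8); §5; §6.4] -/
theorem frontSpeedLimit (hε : 0 < ε₀) (hW : IsEternalVisc ε₀ νh α W) (hc : IsCancellingCoeff α)
    {B : ℝ} (hB : ∀ (k : ℤ) (σ : ℝ), ‖W k σ‖ ≤ B) {n : ℤ} {σ₀ σ q : ℝ} (h0σ : σ₀ ≤ σ)
    (hq4 : 4 * fluxConst α * q ≤ bigLam ε₀) (hq2 : 2 * bigLam ε₀ * fluxConst α * q ^ 2 < q)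
    (hqb : q < 2 * bigLam ε₀ * fluxConst α * B ^ 2)
    (h0 : ∀ k : ℤ, n + 1 ≤ k → ∀ s, s ≤ σ₀ → ‖W k s‖ ≤ q)
    (hn : ∀ s, s ≤ σ → ‖W n s‖ ≤ q) :
    ∀ (j : ℕ) (k : ℤ), n + j ≤ k → ∀ t,
      t ≤ σ + j * Real.log (((2 * bigLam ε₀ * fluxConst α * B ^ 2) ^ 2
              - (2 * bigLam ε₀ * fluxConst α * q ^ 2) ^ 2)
            / ((2 * bigLam ε₀ * fluxConst α * B ^ 2) ^ 2 - q ^ 2)) →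
      ‖W k t‖ ≤ q := by
  set Δ : ℝ := Real.log (((2 * bigLam ε₀ * fluxConst α * B ^ 2) ^ 2
      - (2 * bigLam ε₀ * fluxConst α * q ^ 2) ^ 2)
      / ((2 * bigLam ε₀ * fluxConst α * B ^ 2) ^ 2 - q ^ 2)) with hΔ
  -- Δ > 0 (as in `hop_time`)
  have hΛ : 0 < bigLam ε₀ := bigLam_pos (by linarith)
  have hCA : 0 ≤ fluxConst α := fluxConst_nonneg α
  have hq0 : 0 < q := lt_of_le_of_lt (by positivity) hq2
  have hΔ0 : 0 < Δ := by
    set b : ℝ := 2 * bigLam ε₀ * fluxConst α * B ^ 2 with hb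
    set a : ℝ := 2 * bigLam ε₀ * fluxConst α * q ^ 2 with ha
    have ha0 : 0 ≤ a := by positivity
    have hb0 : 0 < b := hq0.trans hqb
    have hden : 0 < b ^ 2 - q ^ 2 := by nlinarith
    have hnum : b ^ 2 - q ^ 2 < b ^ 2 - a ^ 2 := by nlinarith
    exact Real.log_pos ((one_lt_div hden).2 hnum)
  -- induction on j: the driver of step j+1 is shell n + j, quiet up to σ + jΔ
  intro j
  induction j with
  | zero =>
    intro k hk t ht
    simp only [Nat.cast_zero, add_zero, zero_mul] at hk ht
    rcases eq_or_lt_of_le hk with hkn | hkn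
    · rw [← hkn]; exact hn t ht
    · -- the barrier up to σ
      have hU : UniformBound W := ⟨B, hB⟩
      have hn' : ∀ s, s ≤ σ → ‖W (n + 1 - 1) s‖ ≤ q := by
        intro s hs; rw [add_sub_cancel_right]; exact hn s hs
      exact tail_barrier hε hW hc hU h0σ hq4 hq2 hq2 hn' h0 k (by omega) t ht
  | succ j ih =>
    intro k hk t ht
    -- driver: shell n + j is ≤ q on (-∞, σ + jΔ]
    have hdrv : ∀ s, s ≤ σ + j * Δ → ‖W (n + j) s‖ ≤ q := fun s hs => ih (n + j) le_rfl s hs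
    have h0' : ∀ k' : ℤ, n + j + 1 ≤ k' → ∀ s, s ≤ σ₀ → ‖W k' s‖ ≤ q :=
      fun k' hk' s hs => h0 k' (by omega) s hs
    have hσ' : σ₀ ≤ σ + j * Δ := by
      have : (0 : ℝ) ≤ j * Δ := by positivity
      linarith
    have h := hop_time hε hW hc hB hσ' hq4 hq2 hqb h0' hdrv k (by push_cast at hk ⊢; omega) t
    apply h
    push_cast at ht ⊢
    rw [← hΔ]
    linarith

/-! ## The delay floor of an admissible DSS wave -/

/-- **DSS DELAY FLOOR.**  Let `Φ` be an admissible DSS wave of a cancelling table (`ε₀ > 0`) with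
`‖Φ_r(x)‖ ≤ B`, and `q` a margin level (`4 C_A q ≤ Λ`, `2ΛC_A q² < q`, `q < 2ΛC_A B²`) that some profile
EXCEEDS somewhere.  Then the delay satisfies `T ≥ Δ(B, q) = log((b² - a²)/(b² - q²))`, `b = 2ΛC_A B²`,
`a = 2ΛC_A q²`: shell `p = orderOf π` of the embedded eternal solution repeats shell `0` exactly `pT` later,
and by the front speed limit it cannot ignite before `p·Δ` has elapsed after the ignition of shell `0`.
Fast waves are tall: `Δ(B,q) ≤ T` forces `(2ΛC_A B²)² ≥ (q² - a²e^{-T}… )`, i.e. `B⁴ ≳ q²/(Λ²C_A²T)` for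
small `T`.
[cite: Tao2016AveragedNS, §4 (4.1), (4.3), Lemma 4.1 (4.8); §5; §6.4] -/
theorem dss_delay_ge {ρ : Type*} [Fintype ρ] {π : Equiv.Perm ρ} {T : ℝ} {Φ : ρ → ℝ → Em m}
    (hε : 0 < ε₀) (hW : IsDSSWave ε₀ α π T Φ) (hc : IsCancellingCoeff α)
    {B : ℝ} (hB : ∀ (r : ρ) (x : ℝ), ‖Φ r x‖ ≤ B) {q : ℝ}
    (hq4 : 4 * fluxConst α * q ≤ bigLam ε₀) (hq2 : 2 * bigLam ε₀ * fluxConst α * q ^ 2 < q)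
    (hqb : q < 2 * bigLam ε₀ * fluxConst α * B ^ 2) {r₀ : ρ} {x₀ : ℝ} (hbig : q < ‖Φ r₀ x₀‖) :
    Real.log (((2 * bigLam ε₀ * fluxConst α * B ^ 2) ^ 2 - (2 * bigLam ε₀ * fluxConst α * q ^ 2) ^ 2)
        / ((2 * bigLam ε₀ * fluxConst α * B ^ 2) ^ 2 - q ^ 2)) ≤ T := by
  set Δ : ℝ := Real.log (((2 * bigLam ε₀ * fluxConst α * B ^ 2) ^ 2
      - (2 * bigLam ε₀ * fluxConst α * q ^ 2) ^ 2)
      / ((2 * bigLam ε₀ * fluxConst α * B ^ 2) ^ 2 - q ^ 2)) with hΔ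
  have hΛ : 0 < bigLam ε₀ := bigLam_pos (by linarith)
  have hCA : 0 ≤ fluxConst α := fluxConst_nonneg α
  have hq0 : 0 < q := lt_of_le_of_lt (by positivity) hq2
  set V : ℤ → ℝ → Em m := dssEmbed π T Φ r₀ with hV
  have hE : IsEternalVisc ε₀ 0 α V := isEternalVisc_zero_iff.2 (hW.isEternal_dssEmbed r₀)
  have hBV : ∀ (k : ℤ) (σ : ℝ), ‖V k σ‖ ≤ B := fun k σ => hB _ _
  have hcont : Continuous (V 0) := continuous_iff_continuousAt.2 fun x => (hE.law 0 x).continuousAt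
  -- periodicity: shell p repeats shell 0 after pT
  set p : ℕ := orderOf π with hp
  have hperiod : ∀ s : ℝ, V (p : ℤ) (s + p * T) = V 0 s := by
    intro s
    have hperm : (π ^ ((p : ℕ) : ℤ)) r₀ = r₀ := by
      rw [zpow_natCast, hp, pow_orderOf_eq_one]; rfl
    simp only [hV, dssEmbed, hperm, zpow_zero, Equiv.Perm.coe_one, id_eq, Int.cast_natCast,
      Int.cast_zero, zero_mul, sub_zero]
    congr 1; ring
  -- quiet past of the tail k ≥ 1 and of shell 0
  obtain ⟨σ₀, hσ₀⟩ := dss_exists_quietPast hε hW r₀ 0 hq0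
  -- the last time up to which shell 0 is ≤ q
  set S₀ : Set ℝ := {t | ∀ r : ℝ, ‖V 0 (min r t)‖ ≤ q} with hS₀
  have hS₀iff : ∀ t, t ∈ S₀ ↔ ∀ s, s ≤ t → ‖V 0 s‖ ≤ q := by
    intro t
    constructor
    · intro ht s hs
      have := ht s
      rwa [min_eq_left hs] at this
    · intro ht r
      exact ht (min r t) (min_le_right r t)
  have hS₀closed : IsClosed S₀ := by
    have : S₀ = ⋂ r : ℝ, {t | ‖V 0 (min r t)‖ ≤ q} := by
      ext t; simp only [hS₀, mem_setOf_eq, mem_iInter]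
    rw [this]
    exact isClosed_iInter fun r =>
      isClosed_le (hcont.comp (continuous_const.min continuous_id)).norm continuous_const
  have hS₀ne : S₀.Nonempty := ⟨σ₀, (hS₀iff σ₀).2 fun s hs => hσ₀ 0 le_rfl s hs⟩
  have hx₀V : q < ‖V 0 x₀‖ := by
    simpa only [hV, dssEmbed, zpow_zero, Equiv.Perm.coe_one, id_eq, Int.cast_zero, zero_mul,
      sub_zero] using hbig
  have hS₀bdd : BddAbove S₀ := by
    refine ⟨x₀, fun t ht => ?_⟩
    by_contra hlt
    push Not at hlt
    exact absurd ((hS₀iff t).1 ht x₀ hlt.le) (not_le.2 hx₀V)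
  set σ : ℝ := sSup S₀ with hσdef
  have hσmem : σ ∈ S₀ := hS₀closed.csSup_mem hS₀ne hS₀bdd
  have hn : ∀ s, s ≤ σ → ‖V 0 s‖ ≤ q := (hS₀iff σ).1 hσmem
  -- the front speed limit from shell 0 at time σ: shells ≥ p are ≤ q up to σ + pΔ
  have h0' : ∀ k : ℤ, (0 : ℤ) + 1 ≤ k → ∀ s, s ≤ min σ₀ σ → ‖V k s‖ ≤ q :=
    fun k hk s hs => hσ₀ k (by omega) s (hs.trans (min_le_left _ _))
  have hlim := frontSpeedLimit hε hE hc hBV (min_le_right σ₀ σ) hq4 hq2 hqb h0' hn p (p : ℤ)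
    (by simp)
  -- hence shell 0 is ≤ q up to σ + p(Δ - T)
  by_contra hT
  push Not at hT
  have hp0 : 0 < p := orderOf_pos π
  have hp0' : (0 : ℝ) < p := by exact_mod_cast hp0
  have hgain : 0 < (p : ℝ) * (Δ - T) := mul_pos hp0' (by linarith)
  have hmem' : σ + p * (Δ - T) ∈ S₀ := by
    refine (hS₀iff _).2 fun s hs => ?_
    have h1 := hlim (s + p * T) (by rw [← hΔ]; nlinarith)
    rwa [hperiod s] at h1
  have := le_csSup hS₀bdd hmem'
  linarith

end Summit.NavierStokesRegularity.NavierStokesRegularity.Theorems.NoSurvivingEternalViscBddOne.TailBarrier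

end
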